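import Summits.BirchSwinnertonDyer.Rank1Residual.X11b.KolyvaginH44Concrete
import Summits.BirchSwinnertonDyer.BirchSwinnertonDyer.Theorems.SylvesterTwoHeegnerIndexUpperOffV0H44OfTraceRelationSupersingular
import HarnessLib

/-!
# K7t crux `UpperOffV0HSYPlus` (item 19804), line `offv0-kolyvagin2`, the `2`-adic local clause `h44`,
# layer 4: x11b3's CONCRETE `h44` (`h44_concrete_of_traceRelation_of_congruence`) at SUPERSINGULAR
# Kolyvagin primes, any prime `p` — the shape consumed by `hpoints_at_of_perLevelChoice_of_admissible_of_h44`

Helper file of route `SylvesterTwoHeegnerIndex` (cell bsd-cm, rung K7t): x11b3's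
`KolyvaginH44.h44_concrete_of_traceRelation_of_congruence` (`X11b/KolyvaginH44Concrete`) token for
token, with `(hp2) (hW)` replaced by `hss` («`a_ℓ(W) = 0` at every Kolyvagin prime of level `p^M`»)
and the glue call replaced by k7t-c2 g6's `h44_of_traceRelation_of_congruence_of_dvd_of_supersingular`.
With this, the labelled input `h44` of `hpoints_at_two_of_perLevelChoice_sylvester` is SUPPLIED at
`p = 2` from {(γ) = `hγ`, `hss`} — i.e. the `2`-adic local clause of the line reduces to Gross's
Prop. 3.7 (2) (cite-only, as at odd `p`) plus «the Kolyvagin primes of `E_p` at `2` are supersingular»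
(`ℓ ≡ 2 (mod 3)`, `j = 0`).  Pass-through plumbing (x11b3's text, credited there); no definition, no
named fact, no `sorry`; B14 = O12 open as a class; BSD not claimed.
References: [McCallumLMS1991] Prop. 4.4, Lemma 4.3, §4 (4)–(6); [GrossLMS1991] Prop. 3.7, 3.6, §4 (4.1), 6.2 (2).
-/

set_option autoImplicit false
set_option linter.dupNamespace false

noncomputable section

open scoped Classical
open WeierstrassCurve Field NumberField IsDedekindDomain Finset
open Literature.NumberTheory.EllipticCurves Literature.NumberTheory.GaloisRepresentations
open Literature.NumberTheory.EllipticCurves.KolyvaginCocycle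
open Literature.NumberTheory.EllipticCurves.KolyvaginEuler
open Literature.NumberTheory.EllipticCurves.RingClassField
open Literature.NumberTheory.EllipticCurves.ModularForms
open Summit.BirchSwinnertonDyer.Rank1Residual.X11b
open Summit.BirchSwinnertonDyer.Rank1Residual.X11b.KolyvaginH44

namespace Summit.BirchSwinnertonDyer.BirchSwinnertonDyer.Theorems.SylvesterTwoUpper

-- `K : Type`: the tree's ring-class class field theory is universe `0`.
variable {K : Type} [Field K] [NumberField K] {N : ℕ} {W : WeierstrassCurve ℚ}

/-- **The `h44` clause for CONCRETE Kolyvagin–Heegner data from the trace relation and the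
Eichler–Shimura congruence, at SUPERSINGULAR Kolyvagin primes, any prime `p`** (x11b3's
`h44_concrete_of_traceRelation_of_congruence`, `hp2`/`hW` → `hss`): labelled remainder
{`hA`, `hPt`, `hI`, `hγ`, `hss`}. [cite: McCallumLMS1991, Prop. 4.4, Lemma 4.3, §4 (4)–(6), p. 282 l. 1]
[cite: GrossLMS1991, Prop. 3.7 (1)(2), Prop. 3.6, Lemma 4.3, §3 (3.1)–(3.5), §4 (4.1), (4.4), Prop. 6.2 (2)] -/
theorem h44_concrete_of_traceRelation_of_congruence_of_supersingular [NeZero N] [W.IsElliptic] [W.IsGloballyMinimal]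
    (hK : IsImaginaryQuadratic K) (ι : K →+* ℂ)
    {P : (W.baseChange K).toAffine.Point} (hHP : IsHeegnerPoint N W K P)
    {p M : ℕ} (hp : p.Prime) (hM : 1 ≤ M)
    (hss : ∀ ℓ : ℕ, IsKolyvaginPrime N W K p ℓ → FrobEqFrobInfty W K (p ^ M) ℓ →
      W.frobeniusTrace ℓ = 0)
    (Dt : ModularParametrizationData W N) {β : ℤ}
    (hND : IsCoprime (N : ℤ) (NumberField.discr K)) (hD : NumberField.discr K < -4)
    {n : ℕ} (hn : Squarefree n)
    (hKol : ∀ q ∈ n.primeFactors, IsKolyvaginPrime N W K p q ∧ FrobEqFrobInfty W K (p ^ M) q)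
    (d : (m : ℕ) → m ∣ n → KolyvaginHeegnerData Dt β ι m)
    (hcoh : ∀ (m : ℕ) (hm : m ∣ n) (ℓ : ℕ) (hℓ : ℓ ∈ m.primeFactors)
      (hle : ringClassField K ι (m / ℓ) ≤ ringClassField K ι m),
      letI : Algebra K ℂ := ι.toAlgebra
      (d m hm).toGeomPoints
          (KolyvaginOperator.derivedPoint (pointGalHom W (ringClassField K ι m)) (d m hm).σ (m / ℓ)
            (d m hm).S
            (WeierstrassCurve.Affine.Point.map (W' := W)
              ((RingClassField.inclusion ι hle).restrictScalars ℚ)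
              (d (m / ℓ) ((Nat.div_dvd_of_dvd (Nat.dvd_of_mem_primeFactors hℓ)).trans hm)).y)) =
        (d (m / ℓ) ((Nat.div_dvd_of_dvd (Nat.dvd_of_mem_primeFactors hℓ)).trans hm)).toGeomPoints
          (d (m / ℓ) ((Nat.div_dvd_of_dvd (Nat.dvd_of_mem_primeFactors hℓ)).trans hm)).derivedPoint)
    (hγ : ∀ (m : ℕ) (hm : m ∣ n) (ℓ : ℕ) (hℓ : ℓ ∈ m.primeFactors) [Fact ℓ.Prime]
      (hΔ : ¬ (ℓ : ℤ) ∣ minimalDiscriminantInt W) (φ₀ : absoluteGaloisGroup (ZMod ℓ)),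
      (∀ x : AlgebraicClosure (ZMod ℓ), φ₀ • x = x ^ ℓ) →
      ∀ (hle : ringClassField K ι (m / ℓ) ≤ ringClassField K ι m)
        (γ : ringClassField K ι m ≃ₐ[ℚ] ringClassField K ι m), γ ∈ ringClassGal ι m →
        geomReduction hΔ ((RatClosure.pointsEquiv (K := K) W).symm
            ((d m hm).toGeomPoints (pointGalHom W (ringClassField K ι m) γ (d m hm).y))) =
          φ₀ • geomReduction hΔ ((RatClosure.pointsEquiv (K := K) W).symm
            ((d m hm).toGeomPoints (pointGalHom W (ringClassField K ι m) γ
              (WeierstrassCurve.Affine.Point.map (W' := W)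
                ((RingClassField.inclusion ι hle).restrictScalars ℚ)
                (d (m / ℓ) ((Nat.div_dvd_of_dvd (Nat.dvd_of_mem_primeFactors hℓ)).trans hm)).y)))))
    (hA : ∀ (m : ℕ) (hm : m ∣ n),
      IsAdmissible (absoluteGaloisGroup K) (d m hm).pointsSubgroup ((p ^ M : ℕ) : ℤ))
    (hPt : ∀ (m : ℕ) (hm : m ∣ n),
      (d m hm).toGeomPoints (d m hm).derivedPoint ∈
        invPoints (absoluteGaloisGroup K) (d m hm).pointsSubgroup ((p ^ M : ℕ) : ℤ))
    (hI : ∀ (m : ℕ) (hm : m ∣ n), ∀ v : HeightOneSpectrum (𝓞 K), (m : 𝓞 K) ∉ v.asIdeal →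
      ∀ 𝔐 ∈ v.localPrimesAbove, ∀ t ∈ 𝔐.inertia (absoluteGaloisGroup (v.adicCompletion K)),
        resGal (K := K) (v.adicCompletion K) t • (d m hm).toGeomPoints (d m hm).derivedPoint =
          (d m hm).toGeomPoints (d m hm).derivedPoint) :
    ∀ (m : ℕ) (hm : m ∣ n) (ℓ : ℕ), ℓ.Prime → ∀ (hℓm : ℓ ∣ m) (v : HeightOneSpectrum (𝓞 K)),
      (ℓ : 𝓞 K) ∈ v.asIdeal → ∀ a : ℕ,
        (((p : ℤ) ^ a) • (d m hm).kolyvaginClass hp M ∈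
            selmerLocalKer (W.baseChange K) (v.adicCompletion K) ((p ^ M : ℕ) : ℤ) ↔
          ((p : ℤ) ^ a) • (d (m / ℓ) ((Nat.div_dvd_of_dvd hℓm).trans hm)).kolyvaginClass hp M ∈
            (W.baseChange K).torsionLocalKer (v.adicCompletion K) ((p ^ M : ℕ) : ℤ)) := by
  intro m hm ℓ hℓ hℓm v hv a
  have hn0 : n ≠ 0 := Squarefree.ne_zero hn
  have hinert : ∀ q ∈ n.primeFactors, (Ideal.span {(q : 𝓞 K)}).IsPrime :=
    fun q hq ↦ (hKol q hq).1.2.2.2.2.1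
  have hdiv : ∀ Q : geomPoints (W.baseChange K), ∃ R, ((p ^ M : ℕ) : ℤ) • R = Q :=
    (W.baseChange K).zsmul_geomPoints_surjective_of_charZero
      (by exact_mod_cast pow_ne_zero M hp.ne_zero)
  -- the level data, at every level
  choose σ H f y π j e hord hj hπρ hfsec hHρ hdict hjunk using
    fun k ↦ exists_levelData (W := W) (Dt := Dt) (β := β) hK ι hn hinert d k
  -- `𝒢_m = ringClassGal ι m` is a finite commutative group acting on `E(K[m])` through `pointGalHom`
  letI hcg : ∀ k, CommGroup (ringClassGal ι k) := fun k ↦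
    { (inferInstance : Group (ringClassGal ι k)) with
      mul_comm := fun a b ↦ (isMulCommutative_ringClassGal' hK ι k).is_comm.comm a b }
  haveI hfin : ∀ k, Finite (ringClassGal ι k) := finite_ringClassGal hK ι
  letI act : ∀ k, DistribMulAction (ringClassGal ι k)
      ((W.baseChange (ringClassField K ι k)).toAffine.Point) := fun k ↦
    DistribMulAction.compHom _ ((pointGalHom W (ringClassField K ι k)).comp (ringClassGal ι k).subtype)
  letI hft : ∀ k, Fintype (ringClassGal ι k ⧸ H k) := fun k ↦ Fintype.ofFinite _
  have hsmul : ∀ (k) (g : ringClassGal ι k) (Q : (W.baseChange (ringClassField K ι k)).toAffine.Point),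
      g • Q = pointGalHom W (ringClassField K ι k)
        (g : ringClassField K ι k ≃ₐ[ℚ] ringClassField K ι k) Q := fun _ _ _ ↦ rfl
  -- the inclusion `ρ_m : 𝒢_m ≤ Aut_ℚ(K[m])` and the identity `iA_m`
  set ρ : ∀ k, ringClassGal ι k →* (ringClassField K ι k ≃ₐ[ℚ] ringClassField K ι k) :=
    fun k ↦ (ringClassGal ι k).subtype with hρdef
  have hρ : ∀ k, Function.Injective (ρ k) := fun k ↦ (ringClassGal ι k).subtype_injective
  -- the END's structural hypotheses
  have hj' : ∀ (k) (g : absoluteGaloisGroup K) (a : (W.baseChange (ringClassField K ι k)).toAffine.Point),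
      j k (π k g • a) = g • j k a := fun k g a ↦ by rw [hsmul]; exact hj k g a
  -- the abstract Kolyvagin point IS `P(m)` at the divisors (x11b3-p8's G1)
  have hP : ∀ (k) (hk : k ∣ n),
      j k (kolyvaginPoint (σ k) k.primeFactors (f k) (y k)) =
        (d k hk).toGeomPoints (d k hk).derivedPoint := by
    intro k hk
    obtain ⟨hjk, hyk, hσk, hfS⟩ := hdict k hk
    rw [hjk, hyk]
    congr 1
    have hbij := KolyvaginH37Bridge.bijOn_of_section_of_transversal (ρ k) (hρ k)
      (H := H k) (Γ := ringClassGal ι k) (G₁ := ringClassGalOver ι k 1) (hHρ k)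
      (S := ((d k hk).S : Set _)) (fun s hs ↦ (d k hk).S_subset s hs)
      (fun s hs ↦ ⟨⟨s, (d k hk).S_subset s hs⟩, rfl⟩) (d k hk).S_transversal (f k) (hfsec k) hfS
    exact KolyvaginH37Bridge.map_kolyvaginPoint_eq_derivedPoint
      (pointGalHom W (ringClassField K ι k)) (ρ k) (AddMonoidHom.id _) (fun g a ↦ hsmul k g a)
      (hn.squarefree_of_dvd hk) hσk (f k) hbij (d k hk).y
  have hA' : ∀ k, IsAdmissible (absoluteGaloisGroup K) (j k).range ((p ^ M : ℕ) : ℤ) := by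
    intro k
    by_cases hk : k ∣ n
    · rw [(hdict k hk).1]; exact hA k hk
    · rw [hjunk k hk]
      refine ⟨fun g a ha ↦ ?_, fun a ha _ ↦ ?_⟩
      · obtain ⟨x, hx⟩ := ha
        rw [AddMonoidHom.zero_apply] at hx
        rw [← hx, smul_zero]
        exact AddSubgroup.zero_mem _
      · obtain ⟨x, hx⟩ := ha
        rw [AddMonoidHom.zero_apply] at hx
        exact hx.symm
  have hPt' : ∀ k, j k (kolyvaginPoint (σ k) k.primeFactors (f k) (y k)) ∈
      invPoints (absoluteGaloisGroup K) (j k).range ((p ^ M : ℕ) : ℤ) := by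
    intro k
    by_cases hk : k ∣ n
    · rw [hP k hk, (hdict k hk).1]; exact hPt k hk
    · rw [hjunk k hk, AddMonoidHom.zero_apply]; exact AddSubgroup.zero_mem _
  have hI' : ∀ k : ℕ, ∀ v : HeightOneSpectrum (𝓞 K), (k : 𝓞 K) ∉ v.asIdeal →
      ∀ 𝔐 ∈ v.localPrimesAbove, ∀ t ∈ 𝔐.inertia (absoluteGaloisGroup (v.adicCompletion K)),
        resGal (K := K) (v.adicCompletion K) t • j k (kolyvaginPoint (σ k) k.primeFactors (f k) (y k)) =
          j k (kolyvaginPoint (σ k) k.primeFactors (f k) (y k)) := by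
    intro k w hkw 𝔐 h𝔐 t ht
    by_cases hk : k ∣ n
    · rw [hP k hk]; exact hI k hk w hkw 𝔐 h𝔐 t ht
    · rw [hjunk k hk, AddMonoidHom.zero_apply, smul_zero]
  -- the bridge's dictionary at the divisors
  have hσA : ∀ (k : ℕ) (hk : k ∣ n), ∀ q ∈ k.primeFactors, ρ k (σ k q) = (d k hk).σ q :=
    fun k hk ↦ (hdict k hk).2.2.1
  have hjA : ∀ (k : ℕ) (hk : k ∣ n) (a : (W.baseChange (ringClassField K ι k)).toAffine.Point),
      j k a = (d k hk).toGeomPoints (AddEquiv.refl _ a) := fun k hk a ↦ by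
    rw [(hdict k hk).1]; rfl
  have hyA : ∀ (k : ℕ) (hk : k ∣ n), AddEquiv.refl _ (y k) = (d k hk).y := fun k hk ↦ (hdict k hk).2.1
  have hfS : ∀ (k : ℕ) (hk : k ∣ n) (c : ringClassGal ι k ⧸ H k), ρ k (f k c) ∈ (d k hk).S :=
    fun k hk ↦ (hdict k hk).2.2.2
  have hSρ : ∀ (k : ℕ) (hk : k ∣ n), ((d k hk).S : Set _) ⊆ Set.range (ρ k) :=
    fun k hk s hs ↦ ⟨⟨s, (d k hk).S_subset s hs⟩, rfl⟩
  -- the END of the `h44` programme fed by the bridge, on these data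
  have hEND := h44_of_traceRelation_of_congruence_of_dvd_of_supersingular hK ι hHP hp hM hss hdiv
    σ (fun k ↦ k.primeFactors) H f (fun k q hq ↦ hord k q hq) y π j hj' hA' hPt' hI'
    e ρ hρ hπρ Dt hND hD d hcoh hγ (fun _ ↦ AddEquiv.refl _)
    (fun k _ g a ↦ hsmul k g a) hjA hyA hσA (fun _ _ ↦ rfl) (fun k _ ↦ hfsec k) hfS
    (fun k _ ↦ hHρ k) (fun k _ g ↦ g.2) hSρ m hm (hn.squarefree_of_dvd hm)
    (fun q hq ↦ hKol q (Nat.primeFactors_mono hm hn0 hq)) ℓ hℓ hℓm v hv a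
  -- the END's classes are the concrete classes `c_M(m)`, `c_M(m/ℓ)`
  have hm' : m / ℓ ∣ n := (Nat.div_dvd_of_dvd hℓm).trans hm
  have hc : ∀ (k : ℕ) (hk : k ∣ n), (d k hk).kolyvaginClass hp M =
      kolyvaginClass (W.baseChange K) ((p ^ M : ℕ) : ℤ) hdiv (hA' k)
        (j k (kolyvaginPoint (σ k) k.primeFactors (f k) (y k))) (hPt' k) := by
    intro k hk
    rw [KolyvaginHeegnerData.kolyvaginClass_of_admissible _ hp M (hA k hk) (hPt k hk)]
    exact kolyvaginClass_congr (by rw [(hdict k hk).1]; rfl) (hP k hk).symm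
  rw [hc m hm, hc (m / ℓ) hm']
  exact hEND

end Summit.BirchSwinnertonDyer.BirchSwinnertonDyer.Theorems.SylvesterTwoUpper

end
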